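import Summits.ABC.IUTFork.Repair.RH2SigmaHull
import Summits.ABC.IUTFork.Conditional.AbcOfSGenuineKWindowTheta
import HarnessLib

/-!
# R-H ROUND 2, Q2 «S restricted to Σ», hull-reach family (rows 15 ⊋ 8, 16, 18) — seat abc-iut-rh2-q2-hull, companion of `Repair/RH2SigmaHull.lean`:
# the door at the CHOSEN realising ideles of the window certificates = the binder `hSHw` of `Conditional.abc_of_SH_v10K_window` at one datum

PROOF-ONLY file (D-0012: 0 definitions, 0 `Prop` facts; abc-iut cell, rung LADDER-ABC:A2.RESCUE.H; seat abc-iut-rh2-q2-hull gen 0). TAKES NO SIDE on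
[IUTchIII] Cor. 3.12 or on any author; the slot-reach window (abc-iut-lens-wuc-1 / abc-iut-rh-typ-12 p457641) is an R-H CANDIDATE = a HYPOTHESIS SHAPE,
never asserted; typed ≠ proved; instantiated ≠ endorsed; nothing here asserts abc. The companion discharged the door's dictionary binders at the genuine
bed `Cor312Prov.pilotDataOfK D K` for ANY realising ideles (`RH2SigmaHull.pilotKummerCompatHull_ofShells_pilotDataOfK_of_slotReachWindowK`, Σ-local twin
`qRegion_subset_thetaHull_pilotDataOfK_of_slotReachOn`); here they are specialised to the CHOSEN realising ideles
`(Cor312Prov.exists_realising_qIdeles_pilotDataOfK D).choose` / `(Cor312Prov.exists_realising_thetaIdeles_pilotDataOfK D).choose` and the analytic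
logarithm family `analyticLogv K` — i.e. to the exact bed of the window certificates (`Conditional.abc_of_SH_v8K_window` ff., p444039 / p447945 / p450130):

* `pilotKummerCompatHull_chosen_of_slotReachWindowK` — «datum in Σ₁₅ (certified dictionary + `SlotReachWindowK`) ⟹ the BODY of `hSHw` at that datum»;
* `qRegion_subset_thetaHull_chosen_of_slotReachOn` — «clauses on a packet stratum Σ ⟹ the (xi-f) inclusion on Σ̂ = Σ ∪ {j = 0} ∪ {v_ℚ = ∞}» (S_H|Σ).

HONEST SCOPE as in the companion: OUR typed objects ((Ind2) of Dupuy–Hilado, STRONGER-THAN-PRINT; SHARP boxes; hull-level reading of Step (xi-f));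
«the hull clause follows from the window AS TYPED», nothing more. [cite: DupuyHilado2025, §3.3, §3.4, §3.9, §4.9] [cite: WeilBNT1967, Ch. II §2, Th. 1]
[cite: Mochizuki2012, IUTchI Ex. 3.2 (iv) p. 71; IUTchIII Cor. 3.12 Step (xi-f) p. 184] [claim: Mochizuki2012, status: disputed]. Axioms: standard.
-/

noncomputable section

open Set Function
open scoped Pointwise

namespace Summit.ABC.IUTFork.Repair.RH2SigmaHull

open Thm311 Thm311.Real Cor312 Cor312.Setting Cor312Vol Cor312Prov Literature.IUT.LogThetaLattice Literature.IUT.LogVolume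
  Literature.IUT.HodgeTheaters
open Literature.NumberTheory.NumberFields NumberField IsDedekindDomain Metric RHSlotReach RHSlotReachGlue RHSlotReachLocal

/-! ## §3. The CHOSEN realising ideles of the window certificates -/

section Chosen

variable {F K Fbar : Type} [Field F] [NumberField F] [Field K] [NumberField K] [Algebra F K] [Field Fbar]
  [Algebra F Fbar] [Algebra K Fbar] {E : WeierstrassCurve F} [E.IsElliptic] {l : ℕ} {Pb : BadPlacePredicates K}
  (D : InitialThetaData F K Fbar E l Pb)
  (M : Type) [Field M] [NumberField M]
  (archPk : ∀ (j : (thetaIndex (pilotDataOfK D K)).Label) (vQ : (thetaIndex (pilotDataOfK D K)).VQ),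
    Set ((logShellsDH (pilotDataOfK D K) (analyticLogv K)).Packet j vQ))
  (archSub : ∀ (j : (thetaIndex (pilotDataOfK D K)).Label) (v : (thetaIndex (pilotDataOfK D K)).V),
    Set ((logShellsDH (pilotDataOfK D K) (analyticLogv K)).Packet j ((thetaIndex (pilotDataOfK D K)).over v)))
  (Ψ : ℤ → ∀ v : (thetaIndex (pilotDataOfK D K)).V, v ∈ (thetaIndex (pilotDataOfK D K)).Vbad →
    Set ((logShellsDH (pilotDataOfK D K) (analyticLogv K)).StarPacket v))
  (act : ℤ → ∀ v : (thetaIndex (pilotDataOfK D K)).V, v ∈ (thetaIndex (pilotDataOfK D K)).Vbad →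
    (logShellsDH (pilotDataOfK D K) (analyticLogv K)).StarPacket v →
      Module.End ℚ ((logShellsDH (pilotDataOfK D K) (analyticLogv K)).StarPacket v))
  (Mmod : ℤ → ∀ j : (thetaIndex (pilotDataOfK D K)).LabelStar, Set ((logShellsDH (pilotDataOfK D K) (analyticLogv K)).GlobalPacket j.1))
  (region : ℤ → ∀ j : (thetaIndex (pilotDataOfK D K)).LabelStar, FinDivisor M → ∀ vQ : (thetaIndex (pilotDataOfK D K)).VQ,
    Set ((logShellsDH (pilotDataOfK D K) (analyticLogv K)).Packet j.1 vQ))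
  (frobAdm : ℤ → ℤ → ∀ (j : (thetaIndex (pilotDataOfK D K)).Label) (vQ : (thetaIndex (pilotDataOfK D K)).VQ),
    Set ((logShellsDH (pilotDataOfK D K) (analyticLogv K)).Packet j vQ) → Prop)
  (frobLogvol : ℤ → ℤ → ∀ (j : (thetaIndex (pilotDataOfK D K)).Label) (vQ : (thetaIndex (pilotDataOfK D K)).VQ),
    Set ((logShellsDH (pilotDataOfK D K) (analyticLogv K)).Packet j vQ) → ℝ)
  (frobΨ : ℤ → ℤ → ∀ v : (thetaIndex (pilotDataOfK D K)).V, v ∈ (thetaIndex (pilotDataOfK D K)).Vbad →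
    Set ((logShellsDH (pilotDataOfK D K) (analyticLogv K)).StarPacket v))
  (frobMmod : ℤ → ℤ → ∀ j : (thetaIndex (pilotDataOfK D K)).LabelStar,
    Set ((logShellsDH (pilotDataOfK D K) (analyticLogv K)).GlobalPacket j.1))
  (unitImage : ℤ → ℤ → ℕ → ∀ (j : (thetaIndex (pilotDataOfK D K)).Label) (vQ : (thetaIndex (pilotDataOfK D K)).VQ),
    Set ((logShellsDH (pilotDataOfK D K) (analyticLogv K)).Packet j vQ))
  (ballImage : ℤ → ℤ → ∀ (j : (thetaIndex (pilotDataOfK D K)).Label) (vQ : (thetaIndex (pilotDataOfK D K)).VQ),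
    Set ((logShellsDH (pilotDataOfK D K) (analyticLogv K)).Packet j vQ))
  (thetaDiv : ℤ → ℤ → LgpDivisor M (thetaIndex (pilotDataOfK D K)).lstar)
  (n : ℤ) {HT : Type} {LogLink : HT → HT → Type} {IsFull : ∀ {s t : HT}, LogLink s t → Prop}
  (lat : LGPGaussianLogThetaLattice LogLink IsFull)
  {Frd : Type} {IsoF : Frd → Frd → Type} {Ob : Frd → Type} {realify : Frd → Frd} {Strip : Type}
  {IsoS : Strip → Strip → Type}
  {Mv : ∀ v : (thetaIndex (pilotDataOfK D K)).V, v ∈ (thetaIndex (pilotDataOfK D K)).Vbad → Type} [∀ v h, Monoid (Mv v h)]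
  (sig : GlobalLGPFrobenioidSignature (thetaIndex (pilotDataOfK D K)).lstar (thetaIndex (pilotDataOfK D K)).V
    (· ∈ (thetaIndex (pilotDataOfK D K)).Vbad) Frd IsoF Ob realify Strip IsoS Mv)
  (split : SplittingMonoids Mv) {ObΔ : Type}
  {N : ∀ v : (thetaIndex (pilotDataOfK D K)).V, v ∈ (thetaIndex (pilotDataOfK D K)).Vbad → Type} [∀ v h, Monoid (N v h)]
  (qData : QPilotData ObΔ N)
  (qK : ∀ v : (thetaIndex (pilotDataOfK D K)).V, v ∈ (thetaIndex (pilotDataOfK D K)).Vbad →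
    Set ((logShellsDH (pilotDataOfK D K) (analyticLogv K)).StarPacket v))
  -- the STRATUM DATUM
  (n₀ : ∀ pp : Nat.Primes, (thetaIndex (pilotDataOfK D K)).Fibre (.inr pp) → ℕ)
  (lam : ∀ pp : Nat.Primes, (thetaIndex (pilotDataOfK D K)).Fibre (.inr pp) → ℝ)
  (mq : ∀ pp : Nat.Primes, (thetaIndex (pilotDataOfK D K)).Fibre (.inr pp) → ℤ)

/-- **`hSHw` AT ONE DATUM FROM «DATUM IN Σ₁₅» — the CHOSEN realising ideles.** At the bed of the window certificates — `settingPrVolSharp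
(pilotDataOfK D K) (logvAnalytic_analyticLogv) …` with the CHOSEN realising q- and Θ-ideles `(Cor312Prov.exists_realising_qIdeles_pilotDataOfK D).choose`,
`(Cor312Prov.exists_realising_thetaIdeles_pilotDataOfK D).choose` — a certified window dictionary `(n₀, λ, m_q)` with abc-iut-lens-wuc-1's
`SlotReachWindowK D ramIdx n₀ λ (j²·m_q) m_q` gives `PilotKummerCompatHull (LatticeSituation.ofShells …) (settingPrVolSharp …) (fun _ => qRegion) qK`:
LITERALLY the body of the binder `hSHw` of `Conditional.abc_of_SH_v10K_window` (p447945) at the datum `T` with `T.D = D` (any column binders, any `qK`).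
§2 at the chosen ideles; nothing else. No side taken on [IUTchIII] Cor. 3.12; the window is a HYPOTHESIS. [cite: DupuyHilado2025, §3.9, §4.9]
[cite: Mochizuki2012, IUTchI Ex. 3.2 (iv) p. 71] [claim: Mochizuki2012, status: disputed] -/
theorem pilotKummerCompatHull_chosen_of_slotReachWindowK
    (hn₀ : ∀ (pp : Nat.Primes) (x : (thetaIndex (pilotDataOfK D K)).Fibre (.inr pp)), haveI : Fact (pp : ℕ).Prime := ⟨pp.2⟩
      ∃ u : kOf (pilotDataOfK D K) pp.1 x,
        ‖u‖ ≤ (pp : ℝ) ^ (-(((n₀ pp x : ℤ) - 1 : ℤ) : ℝ) / (ramIdx K (placeOf (pilotDataOfK D K) pp.1 x) : ℝ)) ∧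
          u ∉ (logUnits (kOf (pilotDataOfK D K) pp.1 x) : Set (kOf (pilotDataOfK D K) pp.1 x)))
    (hlam : ∀ (pp : Nat.Primes) (x : (thetaIndex (pilotDataOfK D K)).Fibre (.inr pp)), haveI : Fact (pp : ℕ).Prime := ⟨pp.2⟩
      ∃ z ∈ (logUnits (kOf (pilotDataOfK D K) pp.1 x) : Set (kOf (pilotDataOfK D K) pp.1 x)), (pp : ℝ) ^ (lam pp x) ≤ ‖z‖)
    (hmq : ∀ (pp : Nat.Primes) (w : (thetaIndex (pilotDataOfK D K)).Fibre (.inr pp)), haveI : Fact (pp : ℕ).Prime := ⟨pp.2⟩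
      placeOf (pilotDataOfK D K) pp.1 w ∈ (pilotDataOfK D K).S →
        (mq pp w : ℝ) = (pilotDataOfK D K).qPilot (placeOf (pilotDataOfK D K) pp.1 w))
    (hH : SlotReachWindowK D (fun pp x => haveI : Fact (pp : ℕ).Prime := ⟨pp.2⟩; ramIdx K (placeOf (pilotDataOfK D K) pp.1 x)) n₀ lam
      (fun pp i w => ((((i : ℕ) : ℤ) + 1) ^ 2) * mq pp w) mq) :
    PilotKummerCompatHull
      (LatticeSituation.ofShells (logShellsDH (pilotDataOfK D K) (analyticLogv K)) M archPk archSub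
        (summandPiecesPr (pilotDataOfK D K) (logvAnalytic_analyticLogv (F := K))).Adm
        (summandPiecesPr (pilotDataOfK D K) (logvAnalytic_analyticLogv (F := K))).logvol Ψ act Mmod region frobAdm frobLogvol frobΨ
        frobMmod unitImage ballImage thetaDiv)
      (settingPrVolSharp (pilotDataOfK D K) (logvAnalytic_analyticLogv (F := K)) M archPk archSub Ψ act Mmod region n lat sig split qData
        (exists_realising_qIdeles_pilotDataOfK D).choose (exists_realising_thetaIdeles_pilotDataOfK D).choose
        (exists_realising_qIdeles_pilotDataOfK D).choose_spec.1 (exists_realising_qIdeles_pilotDataOfK D).choose_spec.2.1)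
      (fun _ => (settingPrVolSharp (pilotDataOfK D K) (logvAnalytic_analyticLogv (F := K)) M archPk archSub Ψ act Mmod region n lat sig
        split qData (exists_realising_qIdeles_pilotDataOfK D).choose (exists_realising_thetaIdeles_pilotDataOfK D).choose
        (exists_realising_qIdeles_pilotDataOfK D).choose_spec.1 (exists_realising_qIdeles_pilotDataOfK D).choose_spec.2.1).qRegion)
      qK :=
  pilotKummerCompatHull_ofShells_pilotDataOfK_of_slotReachWindowK D (logvAnalytic_analyticLogv (F := K)) M archPk archSub Ψ act Mmod
    region frobAdm frobLogvol frobΨ frobMmod unitImage ballImage thetaDiv n lat sig split qData qK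
    (exists_realising_qIdeles_pilotDataOfK D).choose (exists_realising_thetaIdeles_pilotDataOfK D).choose
    (exists_realising_qIdeles_pilotDataOfK D).choose_spec.1 (exists_realising_qIdeles_pilotDataOfK D).choose_spec.2.1
    (exists_realising_thetaIdeles_pilotDataOfK D).choose_spec.1 (exists_realising_thetaIdeles_pilotDataOfK D).choose_spec.2.1
    (exists_realising_thetaIdeles_pilotDataOfK D).choose_spec.2.2 (exists_realising_qIdeles_pilotDataOfK D).choose_spec.2.2
    n₀ lam mq hn₀ hlam hmq hH

/-- **«S_H ON Σ» AT ONE DATUM — the CHOSEN realising ideles** (Σ-local twin): the slot-reach clauses of a certified dictionary ON a packet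
stratum `σ` give `qRegion j v_ℚ ⊆ ⁿ˒°𝒰_{j,v_ℚ}` at every packet of `Σ̂ = Σ ∪ {j = 0} ∪ {v_ℚ = ∞}` for the certificates' bed. The input
«S_H|Σ» of the weakened-Cor-3.12 target of rh2-q2-cond / rh2-q2-eq. [cite: DupuyHilado2025, §3.9, §4.9] [claim: Mochizuki2012, status: disputed] -/
theorem qRegion_subset_thetaHull_chosen_of_slotReachOn
    (hn₀ : ∀ (pp : Nat.Primes) (x : (thetaIndex (pilotDataOfK D K)).Fibre (.inr pp)), haveI : Fact (pp : ℕ).Prime := ⟨pp.2⟩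
      ∃ u : kOf (pilotDataOfK D K) pp.1 x,
        ‖u‖ ≤ (pp : ℝ) ^ (-(((n₀ pp x : ℤ) - 1 : ℤ) : ℝ) / (ramIdx K (placeOf (pilotDataOfK D K) pp.1 x) : ℝ)) ∧
          u ∉ (logUnits (kOf (pilotDataOfK D K) pp.1 x) : Set (kOf (pilotDataOfK D K) pp.1 x)))
    (hlam : ∀ (pp : Nat.Primes) (x : (thetaIndex (pilotDataOfK D K)).Fibre (.inr pp)), haveI : Fact (pp : ℕ).Prime := ⟨pp.2⟩
      ∃ z ∈ (logUnits (kOf (pilotDataOfK D K) pp.1 x) : Set (kOf (pilotDataOfK D K) pp.1 x)), (pp : ℝ) ^ (lam pp x) ≤ ‖z‖)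
    (hmq : ∀ (pp : Nat.Primes) (w : (thetaIndex (pilotDataOfK D K)).Fibre (.inr pp)), haveI : Fact (pp : ℕ).Prime := ⟨pp.2⟩
      placeOf (pilotDataOfK D K) pp.1 w ∈ (pilotDataOfK D K).S →
        (mq pp w : ℝ) = (pilotDataOfK D K).qPilot (placeOf (pilotDataOfK D K) pp.1 w))
    (σ : Nat.Primes → Fin (thetaIndex (pilotDataOfK D K)).lstar → Prop)
    (hHσ : ∀ (pp : Nat.Primes) (i : Fin (thetaIndex (pilotDataOfK D K)).lstar), σ pp i →
      ∀ w : (thetaIndex (pilotDataOfK D K)).Fibre (.inr pp), haveI : Fact (pp : ℕ).Prime := ⟨pp.2⟩;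
        placeOf (pilotDataOfK D K) pp.1 w ∈ (pilotDataOfK D K).S →
        ∀ x : Fin ((i : ℕ) + 1) → (thetaIndex (pilotDataOfK D K)).Fibre (.inr pp),
          (((((((i : ℕ) : ℤ) + 1) ^ 2) * mq pp w - n₀ pp w) / (ramIdx K (placeOf (pilotDataOfK D K) pp.1 w) : ℤ) : ℤ) : ℝ)
            ≤ (mq pp w : ℝ) / (ramIdx K (placeOf (pilotDataOfK D K) pp.1 w) : ℝ) + lam pp w
              + ∑ a, (lam pp (x a) +
                ((-((-(n₀ pp (x a) : ℤ)) / (ramIdx K (placeOf (pilotDataOfK D K) pp.1 (x a)) : ℤ)) : ℤ) : ℝ)))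
    (j : (thetaIndex (pilotDataOfK D K)).Label) (vQ : (thetaIndex (pilotDataOfK D K)).VQ)
    (hjv : ∀ (pp : Nat.Primes) (i : Fin (thetaIndex (pilotDataOfK D K)).lstar), vQ = .inr pp → j = Setting.labelSucc i → σ pp i) :
    (settingPrVolSharp (pilotDataOfK D K) (logvAnalytic_analyticLogv (F := K)) M archPk archSub Ψ act Mmod region n lat sig split qData
        (exists_realising_qIdeles_pilotDataOfK D).choose (exists_realising_thetaIdeles_pilotDataOfK D).choose
        (exists_realising_qIdeles_pilotDataOfK D).choose_spec.1 (exists_realising_qIdeles_pilotDataOfK D).choose_spec.2.1).qRegion j vQ ⊆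
      (settingPrVolSharp (pilotDataOfK D K) (logvAnalytic_analyticLogv (F := K)) M archPk archSub Ψ act Mmod region n lat sig split qData
        (exists_realising_qIdeles_pilotDataOfK D).choose (exists_realising_thetaIdeles_pilotDataOfK D).choose
        (exists_realising_qIdeles_pilotDataOfK D).choose_spec.1 (exists_realising_qIdeles_pilotDataOfK D).choose_spec.2.1).thetaHull j vQ :=
  qRegion_subset_thetaHull_pilotDataOfK_of_slotReachOn D (logvAnalytic_analyticLogv (F := K)) M archPk archSub Ψ act Mmod region n lat sig
    split qData (exists_realising_qIdeles_pilotDataOfK D).choose (exists_realising_thetaIdeles_pilotDataOfK D).choose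
    (exists_realising_qIdeles_pilotDataOfK D).choose_spec.1 (exists_realising_qIdeles_pilotDataOfK D).choose_spec.2.1
    (exists_realising_thetaIdeles_pilotDataOfK D).choose_spec.1 (exists_realising_thetaIdeles_pilotDataOfK D).choose_spec.2.1
    (exists_realising_thetaIdeles_pilotDataOfK D).choose_spec.2.2 (exists_realising_qIdeles_pilotDataOfK D).choose_spec.2.2
    n₀ lam mq hn₀ hlam hmq σ hHσ j vQ hjv

end Chosen

section Certificate

open Literature.IUT.LogVolume.ThetaData Literature.NumberTheory.DiophantineGeometry.GenEll Summit.ABC.ABC.Theorems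

/-! ## §4. The certificate composition: «every admissible datum off the depth locus lies in Σ₁₅» ⟹ `ABC` along `abc_of_SH_v10K_window` -/

/-- **`abc_of_sigma15_v10K_window` — «S|Σ₁₅ ⟹ abc» for the DATUM-STRATUM Σ₁₅ (R-H round 2, Q2 row 15; rows 8/16 ⊆ 15 by p460910 / p464040).**
Branch C's certificate of record `Conditional.abc_of_SH_v10K_window` (p447945; explicit 3 = S_H(window) · NUM(deep) · CONE) with its S_H binder `hSHw`
REPLACED by the STRATUM binder `hSigma`: «every admissible datum `T` OFF the degree-form depth locus carries a certified window dictionary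
`(n₀, λ, m_q)` for which abc-iut-lens-wuc-1's slot-reach window `SlotReachWindowK T.D ramIdx n₀ λ (j²·m_q) m_q` holds» — i.e. the undecided window
lies inside Σ₁₅. Then `hSHw` is the THEOREM `pilotKummerCompatHull_chosen_of_slotReachWindowK` (§3) at each such datum, and `ABC` follows from
Σ₁₅(window) · NUM(deep) · CONE. Whether genuine data lie in Σ₁₅ (for `l` in the typed window) is Q3 (rh2-q3-num / rh2-q3-typ-1), NOT claimed here;
`hNum`, `hreg` are assumption labels verbatim from p447945. «`ABC` follows from these hypotheses AS TYPED», nothing more; no side taken on [IUTchIII]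
Cor. 3.12; typed ≠ proved; instantiated ≠ endorsed. [claim: Mochizuki2012, status: disputed] [cite: DupuyHilado2025, §3.9, §4.9]
[cite: Mochizuki2012, IUTchIII Cor. 3.12 p. 173–174, Step (xi-f) p. 184; IUTchIV Thm. 1.10 p. 23]
**WARNING (abc-iut-rh2-q2-hull gen 2, after referee abc-iut-rh-ref-3's binding kernel caveat of 2026-08-26): VACUOUS AS TYPED.** The binder `hreg` below
(verbatim from p447945) is KERNEL-REFUTED — `Conditional.not_hreg_v4` (`Conditional/AbcOfSHvolRefutation.lean`; admissible `d_mod = 2` quadratic-witness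
family) — so this implication, though kernel-true, can never be discharged. Its honest replacement is the re-cut (`hreg ↦ hregBad`, C-R28 (3)(α))
`abc_of_sigma15_v10K_window_szpiroBadAll` / `abc_of_inSigma_orNum_K_szpiroBad_hregBad` in `Repair/RH2SigmaHullRecut.lean`; kept here as a record. -/
theorem abc_of_sigma15_v10K_window
    (M : ∀ (P : NFPoint) (l : ℕ) (T : Cor22.ThetaVolumeDatumAt P l), Type) [∀ P l T, Field (M P l T)] [∀ P l T, NumberField (M P l T)]
    (archPk : ∀ (P : NFPoint) (l : ℕ) (T : Cor22.ThetaVolumeDatumAt P l), letI := T.instFieldF; letI := T.instNumberFieldF; letI := T.instAlgebraF; letI := T.instFieldK;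
        letI := T.instNumberFieldK; letI := T.instAlgebraK; letI := T.instFieldFbar; letI := T.instAlgebraFbar;
        letI := T.instAlgebraKFbar; letI := T.instIsElliptic;
      ∀ (j : (thetaIndex (pilotDataOfK T.D T.K)).Label) (vQ : (thetaIndex (pilotDataOfK T.D T.K)).VQ), Set ((logShellsDH (pilotDataOfK T.D T.K) (analyticLogv T.K)).Packet j vQ))
    (archSub : ∀ (P : NFPoint) (l : ℕ) (T : Cor22.ThetaVolumeDatumAt P l), letI := T.instFieldF; letI := T.instNumberFieldF; letI := T.instAlgebraF; letI := T.instFieldK;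
        letI := T.instNumberFieldK; letI := T.instAlgebraK; letI := T.instFieldFbar; letI := T.instAlgebraFbar;
        letI := T.instAlgebraKFbar; letI := T.instIsElliptic;
      ∀ (j : (thetaIndex (pilotDataOfK T.D T.K)).Label) (v : (thetaIndex (pilotDataOfK T.D T.K)).V), Set ((logShellsDH (pilotDataOfK T.D T.K) (analyticLogv T.K)).Packet j ((thetaIndex (pilotDataOfK T.D T.K)).over v)))
    (Ψ : ∀ (P : NFPoint) (l : ℕ) (T : Cor22.ThetaVolumeDatumAt P l), letI := T.instFieldF; letI := T.instNumberFieldF; letI := T.instAlgebraF; letI := T.instFieldK;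
        letI := T.instNumberFieldK; letI := T.instAlgebraK; letI := T.instFieldFbar; letI := T.instAlgebraFbar;
        letI := T.instAlgebraKFbar; letI := T.instIsElliptic;
      ℤ → ∀ v : (thetaIndex (pilotDataOfK T.D T.K)).V, v ∈ (thetaIndex (pilotDataOfK T.D T.K)).Vbad → Set ((logShellsDH (pilotDataOfK T.D T.K) (analyticLogv T.K)).StarPacket v))
    (act : ∀ (P : NFPoint) (l : ℕ) (T : Cor22.ThetaVolumeDatumAt P l), letI := T.instFieldF; letI := T.instNumberFieldF; letI := T.instAlgebraF; letI := T.instFieldK;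
        letI := T.instNumberFieldK; letI := T.instAlgebraK; letI := T.instFieldFbar; letI := T.instAlgebraFbar;
        letI := T.instAlgebraKFbar; letI := T.instIsElliptic;
      ℤ → ∀ v : (thetaIndex (pilotDataOfK T.D T.K)).V, v ∈ (thetaIndex (pilotDataOfK T.D T.K)).Vbad → (logShellsDH (pilotDataOfK T.D T.K) (analyticLogv T.K)).StarPacket v → Module.End ℚ ((logShellsDH (pilotDataOfK T.D T.K) (analyticLogv T.K)).StarPacket v))
    (Mmod : ∀ (P : NFPoint) (l : ℕ) (T : Cor22.ThetaVolumeDatumAt P l), letI := T.instFieldF; letI := T.instNumberFieldF; letI := T.instAlgebraF; letI := T.instFieldK;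
        letI := T.instNumberFieldK; letI := T.instAlgebraK; letI := T.instFieldFbar; letI := T.instAlgebraFbar;
        letI := T.instAlgebraKFbar; letI := T.instIsElliptic;
      ℤ → ∀ j : (thetaIndex (pilotDataOfK T.D T.K)).LabelStar, Set ((logShellsDH (pilotDataOfK T.D T.K) (analyticLogv T.K)).GlobalPacket j.1))
    (region : ∀ (P : NFPoint) (l : ℕ) (T : Cor22.ThetaVolumeDatumAt P l), letI := T.instFieldF; letI := T.instNumberFieldF; letI := T.instAlgebraF; letI := T.instFieldK;
        letI := T.instNumberFieldK; letI := T.instAlgebraK; letI := T.instFieldFbar; letI := T.instAlgebraFbar;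
        letI := T.instAlgebraKFbar; letI := T.instIsElliptic;
      ℤ → ∀ j : (thetaIndex (pilotDataOfK T.D T.K)).LabelStar, FinDivisor (M P l T) → ∀ vQ : (thetaIndex (pilotDataOfK T.D T.K)).VQ, Set ((logShellsDH (pilotDataOfK T.D T.K) (analyticLogv T.K)).Packet j.1 vQ))
    (frobAdm : ∀ (P : NFPoint) (l : ℕ) (T : Cor22.ThetaVolumeDatumAt P l), letI := T.instFieldF; letI := T.instNumberFieldF; letI := T.instAlgebraF; letI := T.instFieldK;
        letI := T.instNumberFieldK; letI := T.instAlgebraK; letI := T.instFieldFbar; letI := T.instAlgebraFbar;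
        letI := T.instAlgebraKFbar; letI := T.instIsElliptic;
      ℤ → ℤ → ∀ (j : (thetaIndex (pilotDataOfK T.D T.K)).Label) (vQ : (thetaIndex (pilotDataOfK T.D T.K)).VQ), Set ((logShellsDH (pilotDataOfK T.D T.K) (analyticLogv T.K)).Packet j vQ) → Prop)
    (frobLogvol : ∀ (P : NFPoint) (l : ℕ) (T : Cor22.ThetaVolumeDatumAt P l), letI := T.instFieldF; letI := T.instNumberFieldF; letI := T.instAlgebraF; letI := T.instFieldK;
        letI := T.instNumberFieldK; letI := T.instAlgebraK; letI := T.instFieldFbar; letI := T.instAlgebraFbar;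
        letI := T.instAlgebraKFbar; letI := T.instIsElliptic;
      ℤ → ℤ → ∀ (j : (thetaIndex (pilotDataOfK T.D T.K)).Label) (vQ : (thetaIndex (pilotDataOfK T.D T.K)).VQ), Set ((logShellsDH (pilotDataOfK T.D T.K) (analyticLogv T.K)).Packet j vQ) → ℝ)
    (frobΨ : ∀ (P : NFPoint) (l : ℕ) (T : Cor22.ThetaVolumeDatumAt P l), letI := T.instFieldF; letI := T.instNumberFieldF; letI := T.instAlgebraF; letI := T.instFieldK;
        letI := T.instNumberFieldK; letI := T.instAlgebraK; letI := T.instFieldFbar; letI := T.instAlgebraFbar;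
        letI := T.instAlgebraKFbar; letI := T.instIsElliptic;
      ℤ → ℤ → ∀ v : (thetaIndex (pilotDataOfK T.D T.K)).V, v ∈ (thetaIndex (pilotDataOfK T.D T.K)).Vbad → Set ((logShellsDH (pilotDataOfK T.D T.K) (analyticLogv T.K)).StarPacket v))
    (frobMmod : ∀ (P : NFPoint) (l : ℕ) (T : Cor22.ThetaVolumeDatumAt P l), letI := T.instFieldF; letI := T.instNumberFieldF; letI := T.instAlgebraF; letI := T.instFieldK;
        letI := T.instNumberFieldK; letI := T.instAlgebraK; letI := T.instFieldFbar; letI := T.instAlgebraFbar;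
        letI := T.instAlgebraKFbar; letI := T.instIsElliptic;
      ℤ → ℤ → ∀ j : (thetaIndex (pilotDataOfK T.D T.K)).LabelStar, Set ((logShellsDH (pilotDataOfK T.D T.K) (analyticLogv T.K)).GlobalPacket j.1))
    (unitImage : ∀ (P : NFPoint) (l : ℕ) (T : Cor22.ThetaVolumeDatumAt P l), letI := T.instFieldF; letI := T.instNumberFieldF; letI := T.instAlgebraF; letI := T.instFieldK;
        letI := T.instNumberFieldK; letI := T.instAlgebraK; letI := T.instFieldFbar; letI := T.instAlgebraFbar;
        letI := T.instAlgebraKFbar; letI := T.instIsElliptic;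
      ℤ → ℤ → ℕ → ∀ (j : (thetaIndex (pilotDataOfK T.D T.K)).Label) (vQ : (thetaIndex (pilotDataOfK T.D T.K)).VQ), Set ((logShellsDH (pilotDataOfK T.D T.K) (analyticLogv T.K)).Packet j vQ))
    (ballImage : ∀ (P : NFPoint) (l : ℕ) (T : Cor22.ThetaVolumeDatumAt P l), letI := T.instFieldF; letI := T.instNumberFieldF; letI := T.instAlgebraF; letI := T.instFieldK;
        letI := T.instNumberFieldK; letI := T.instAlgebraK; letI := T.instFieldFbar; letI := T.instAlgebraFbar;
        letI := T.instAlgebraKFbar; letI := T.instIsElliptic;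
      ℤ → ℤ → ∀ (j : (thetaIndex (pilotDataOfK T.D T.K)).Label) (vQ : (thetaIndex (pilotDataOfK T.D T.K)).VQ), Set ((logShellsDH (pilotDataOfK T.D T.K) (analyticLogv T.K)).Packet j vQ))
    (thetaDiv : ∀ (P : NFPoint) (l : ℕ) (T : Cor22.ThetaVolumeDatumAt P l), letI := T.instFieldF; letI := T.instNumberFieldF; letI := T.instAlgebraF; letI := T.instFieldK;
        letI := T.instNumberFieldK; letI := T.instAlgebraK; letI := T.instFieldFbar; letI := T.instAlgebraFbar;
        letI := T.instAlgebraKFbar; letI := T.instIsElliptic;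
      ℤ → ℤ → LgpDivisor (M P l T) (thetaIndex (pilotDataOfK T.D T.K)).lstar)
    (n : ∀ (P : NFPoint) (l : ℕ) (T : Cor22.ThetaVolumeDatumAt P l), ℤ)
    {HT : ∀ (P : NFPoint) (l : ℕ) (T : Cor22.ThetaVolumeDatumAt P l), Type} {LogLink : ∀ (P : NFPoint) (l : ℕ) (T : Cor22.ThetaVolumeDatumAt P l), HT P l T → HT P l T → Type}
    {IsFull : ∀ (P : NFPoint) (l : ℕ) (T : Cor22.ThetaVolumeDatumAt P l), ∀ {s t : HT P l T}, LogLink P l T s t → Prop}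
    (lat : ∀ (P : NFPoint) (l : ℕ) (T : Cor22.ThetaVolumeDatumAt P l), LGPGaussianLogThetaLattice (LogLink P l T) (IsFull P l T))
    {Frd : ∀ (P : NFPoint) (l : ℕ) (T : Cor22.ThetaVolumeDatumAt P l), Type} {IsoF : ∀ (P : NFPoint) (l : ℕ) (T : Cor22.ThetaVolumeDatumAt P l), Frd P l T → Frd P l T → Type} {Ob : ∀ (P : NFPoint) (l : ℕ) (T : Cor22.ThetaVolumeDatumAt P l), Frd P l T → Type}
    {realify : ∀ (P : NFPoint) (l : ℕ) (T : Cor22.ThetaVolumeDatumAt P l), Frd P l T → Frd P l T} {Strip : ∀ (P : NFPoint) (l : ℕ) (T : Cor22.ThetaVolumeDatumAt P l), Type} {IsoS : ∀ (P : NFPoint) (l : ℕ) (T : Cor22.ThetaVolumeDatumAt P l), Strip P l T → Strip P l T → Type}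
    {Mv : ∀ (P : NFPoint) (l : ℕ) (T : Cor22.ThetaVolumeDatumAt P l), letI := T.instFieldF; letI := T.instNumberFieldF; letI := T.instAlgebraF; letI := T.instFieldK;
        letI := T.instNumberFieldK; letI := T.instAlgebraK; letI := T.instFieldFbar; letI := T.instAlgebraFbar;
        letI := T.instAlgebraKFbar; letI := T.instIsElliptic;
      ∀ v : (thetaIndex (pilotDataOfK T.D T.K)).V, v ∈ (thetaIndex (pilotDataOfK T.D T.K)).Vbad → Type}
    [∀ P l T v h, Monoid (Mv P l T v h)]
    (sig : ∀ (P : NFPoint) (l : ℕ) (T : Cor22.ThetaVolumeDatumAt P l), letI := T.instFieldF; letI := T.instNumberFieldF; letI := T.instAlgebraF; letI := T.instFieldK;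
        letI := T.instNumberFieldK; letI := T.instAlgebraK; letI := T.instFieldFbar; letI := T.instAlgebraFbar;
        letI := T.instAlgebraKFbar; letI := T.instIsElliptic;
      GlobalLGPFrobenioidSignature (thetaIndex (pilotDataOfK T.D T.K)).lstar (thetaIndex (pilotDataOfK T.D T.K)).V (· ∈ (thetaIndex (pilotDataOfK T.D T.K)).Vbad) (Frd P l T) (IsoF P l T) (Ob P l T) (realify P l T)
        (Strip P l T) (IsoS P l T) (Mv P l T))
    (split : ∀ (P : NFPoint) (l : ℕ) (T : Cor22.ThetaVolumeDatumAt P l), SplittingMonoids (Mv P l T))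
    {ObΔ : ∀ (P : NFPoint) (l : ℕ) (T : Cor22.ThetaVolumeDatumAt P l), Type} {N : ∀ (P : NFPoint) (l : ℕ) (T : Cor22.ThetaVolumeDatumAt P l), letI := T.instFieldF; letI := T.instNumberFieldF; letI := T.instAlgebraF; letI := T.instFieldK;
        letI := T.instNumberFieldK; letI := T.instAlgebraK; letI := T.instFieldFbar; letI := T.instAlgebraFbar;
        letI := T.instAlgebraKFbar; letI := T.instIsElliptic;
      ∀ v : (thetaIndex (pilotDataOfK T.D T.K)).V, v ∈ (thetaIndex (pilotDataOfK T.D T.K)).Vbad → Type}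
    [∀ P l T v h, Monoid (N P l T v h)] (qData : ∀ (P : NFPoint) (l : ℕ) (T : Cor22.ThetaVolumeDatumAt P l), QPilotData (ObΔ P l T) (N P l T))
    (qK : ∀ (P : NFPoint) (l : ℕ) (T : Cor22.ThetaVolumeDatumAt P l), letI := T.instFieldF; letI := T.instNumberFieldF; letI := T.instAlgebraF; letI := T.instFieldK;
        letI := T.instNumberFieldK; letI := T.instAlgebraK; letI := T.instFieldFbar; letI := T.instAlgebraFbar;
        letI := T.instAlgebraKFbar; letI := T.instIsElliptic;
      ∀ v : (thetaIndex (pilotDataOfK T.D T.K)).V, v ∈ (thetaIndex (pilotDataOfK T.D T.K)).Vbad → Set ((logShellsDH (pilotDataOfK T.D T.K) (analyticLogv T.K)).StarPacket v))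
    -- [S_H, WINDOW] the hull-level clause at the chosen realising ideles / pinned reading, ONLY at admissible data OFF the depth locus
    -- [Σ₁₅, WINDOW] every admissible datum OFF the depth locus lies in the slot-reach stratum Σ₁₅: a certified dictionary + the window
    (hSigma : ∀ (P : NFPoint), P ∈ UP → ∀ (l : ℕ), l.Prime → 5 ≤ l →
      Cor22.AdmitsCore P → Cor22.CondP2 P l → Cor22.CondP5 P l → Cor22.CondP6 P l →
      ∀ (T : Cor22.ThetaVolumeDatumAt P l), letI := T.instFieldF; letI := T.instNumberFieldF; letI := T.instAlgebraF; letI := T.instFieldK;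
        letI := T.instNumberFieldK; letI := T.instAlgebraK; letI := T.instFieldFbar; letI := T.instAlgebraFbar;
        letI := T.instAlgebraKFbar; letI := T.instIsElliptic;
      ¬ (∃ (pp : Nat.Primes) (_ : 2 < (pp : ℕ)) (i : Fin (thetaIndex (pilotDataOfK T.D T.K)).lstar)
          (x₀ : (thetaIndex (pilotDataOfK T.D T.K)).Fibre (.inr pp)),
        haveI : Fact (pp : ℕ).Prime := ⟨pp.2⟩
        ((pp : ℕ) : ℝ) ^ ((((i : ℕ) : ℝ) + 2) * (4 + 2 * Real.logb (pp : ℕ) (Module.finrank ℚ T.K)) + 1) *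
          ‖(exists_realising_qIdeles_pilotDataOfK T.D).choose pp x₀‖ ^ (((i : ℕ) + 1) ^ 2 - 1) < 1) →
      ∃ (n₀ : ∀ pp : Nat.Primes, (thetaIndex (pilotDataOfK T.D T.K)).Fibre (.inr pp) → ℕ)
        (lam : ∀ pp : Nat.Primes, (thetaIndex (pilotDataOfK T.D T.K)).Fibre (.inr pp) → ℝ)
        (mq : ∀ pp : Nat.Primes, (thetaIndex (pilotDataOfK T.D T.K)).Fibre (.inr pp) → ℤ),
        (∀ (pp : Nat.Primes) (x : (thetaIndex (pilotDataOfK T.D T.K)).Fibre (.inr pp)), haveI : Fact (pp : ℕ).Prime := ⟨pp.2⟩;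
          ∃ u : kOf (pilotDataOfK T.D T.K) pp.1 x,
            ‖u‖ ≤ (pp : ℝ) ^ (-(((n₀ pp x : ℤ) - 1 : ℤ) : ℝ) / (ramIdx T.K (placeOf (pilotDataOfK T.D T.K) pp.1 x) : ℝ)) ∧
              u ∉ (logUnits (kOf (pilotDataOfK T.D T.K) pp.1 x) : Set (kOf (pilotDataOfK T.D T.K) pp.1 x))) ∧
        (∀ (pp : Nat.Primes) (x : (thetaIndex (pilotDataOfK T.D T.K)).Fibre (.inr pp)), haveI : Fact (pp : ℕ).Prime := ⟨pp.2⟩;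
          ∃ z ∈ (logUnits (kOf (pilotDataOfK T.D T.K) pp.1 x) : Set (kOf (pilotDataOfK T.D T.K) pp.1 x)), (pp : ℝ) ^ (lam pp x) ≤ ‖z‖) ∧
        (∀ (pp : Nat.Primes) (w : (thetaIndex (pilotDataOfK T.D T.K)).Fibre (.inr pp)), haveI : Fact (pp : ℕ).Prime := ⟨pp.2⟩;
          placeOf (pilotDataOfK T.D T.K) pp.1 w ∈ (pilotDataOfK T.D T.K).S →
            (mq pp w : ℝ) = (pilotDataOfK T.D T.K).qPilot (placeOf (pilotDataOfK T.D T.K) pp.1 w)) ∧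
        SlotReachWindowK T.D
          (fun pp x => haveI : Fact (pp : ℕ).Prime := ⟨pp.2⟩; ramIdx T.K (placeOf (pilotDataOfK T.D T.K) pp.1 x)) n₀ lam
          (fun pp i w => ((((i : ℕ) : ℤ) + 1) ^ 2) * mq pp w) mq)
    (hNum : ∀ (P : NFPoint), P ∈ UP → ∀ (l : ℕ), l.Prime → 5 ≤ l →
      Cor22.AdmitsCore P → Cor22.CondP2 P l → Cor22.CondP5 P l → Cor22.CondP6 P l →
      ∀ (T : Cor22.ThetaVolumeDatumAt P l), letI := T.instFieldF; letI := T.instNumberFieldF; letI := T.instAlgebraF; letI := T.instFieldK;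
        letI := T.instNumberFieldK; letI := T.instAlgebraK; letI := T.instFieldFbar; letI := T.instAlgebraFbar;
        letI := T.instAlgebraKFbar; letI := T.instIsElliptic;
      (∃ (pp : Nat.Primes) (_ : 2 < (pp : ℕ)) (i : Fin (thetaIndex (pilotDataOfK T.D T.K)).lstar)
          (x₀ : (thetaIndex (pilotDataOfK T.D T.K)).Fibre (.inr pp)),
        haveI : Fact (pp : ℕ).Prime := ⟨pp.2⟩
        ((pp : ℕ) : ℝ) ^ ((((i : ℕ) : ℝ) + 2) * (4 + 2 * Real.logb (pp : ℕ) (Module.finrank ℚ T.K)) + 1) *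
          ‖(exists_realising_qIdeles_pilotDataOfK T.D).choose pp x₀‖ ^ (((i : ℕ) + 1) ^ 2 - 1) < 1) → T.Cor312Of)
    (hreg : ∀ P : NFPoint, P ∈ UP → ∀ l : ℕ, l.Prime → 5 ≤ l →
      Cor22.AdmitsCore P → Cor22.CondP2 P l → Cor22.CondP5 P l → Cor22.CondP6 P l →
      ∀ T : Cor22.ThetaVolumeDatumAt P l,
        (letI := T.instFieldF; letI := T.instNumberFieldF; letI := T.instAlgebraF; letI := T.instFieldK
         letI := T.instNumberFieldK; letI := T.instAlgebraK; letI := T.instFieldFbar; letI := T.instAlgebraFbar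
         letI := T.instAlgebraKFbar; letI := T.instIsElliptic
         ¬ (∀ p ∈ T.I.supportPrimes, ∀ v w : placesOver (fieldOfModuli T.E) p,
            (Summit.ABC.IUTFork.DHData.ofInput T.I).logQloc p v = (Summit.ABC.IUTFork.DHData.ofInput T.I).logQloc p w)) →
        T.HullEstimateOf
          (((l : ℝ) + 1) / 4 *
            ((1 + 12 * (Cor22.dmod P : ℝ) / l) * (P.logDiff + Cor22.logCondAvoid P {2, l})
              + 2 * Real.log l + 52
              + 20 / 3 * Real.log (((2 ^ 12 * 3 ^ 3 * 5 * Cor22.dmod P : ℕ) : ℝ) * (l : ℝ))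
                * (Nat.primeCounting (2 ^ 12 * 3 ^ 3 * 5 * Cor22.dmod P * l) : ℝ))))
    : _root_.ABC :=
  Conditional.abc_of_SH_v10K_window (M := M) (archPk := archPk) (archSub := archSub) (Ψ := Ψ) (act := act) (Mmod := Mmod) (region := region)
    (frobAdm := frobAdm) (frobLogvol := frobLogvol) (frobΨ := frobΨ) (frobMmod := frobMmod) (unitImage := unitImage) (ballImage := ballImage)
    (thetaDiv := thetaDiv) (n := n) (lat := lat) (sig := sig) (split := split) (qData := qData) (qK := qK) (hNum := hNum) (hreg := hreg)
    (hSHw := fun P hP l hl h5 hc h2 h5' h6 T hT => by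
      letI := T.instFieldF; letI := T.instNumberFieldF; letI := T.instAlgebraF; letI := T.instFieldK
      letI := T.instNumberFieldK; letI := T.instAlgebraK; letI := T.instFieldFbar; letI := T.instAlgebraFbar
      letI := T.instAlgebraKFbar; letI := T.instIsElliptic
      obtain ⟨n₀, lam, mq, hn₀, hlam, hmq, hH⟩ := hSigma P hP l hl h5 hc h2 h5' h6 T hT
      exact pilotKummerCompatHull_chosen_of_slotReachWindowK T.D (M P l T) (archPk P l T) (archSub P l T) (Ψ P l T) (act P l T)
        (Mmod P l T) (region P l T) (frobAdm P l T) (frobLogvol P l T) (frobΨ P l T) (frobMmod P l T) (unitImage P l T) (ballImage P l T)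
        (thetaDiv P l T) (n P l T) (lat P l T) (sig P l T) (split P l T) (qData P l T) (qK P l T) n₀ lam mq hn₀ hlam hmq hH)

end Certificate

end Summit.ABC.IUTFork.Repair.RH2SigmaHull

end
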